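import Literature.AlgebraicGeometry.Resolution.BlowupFibreConeModel
import Literature.AlgebraicGeometry.Resolution.RegularLocalRingsQuotient
import Literature.AlgebraicGeometry.Resolution.RegularLocalRingsProofs
import Mathlib.RingTheory.RegularLocalRing.Defs
import Mathlib.RingTheory.Ideal.KrullsHeightTheorem
import Mathlib.RingTheory.Ideal.IsPrimary
import Mathlib.LinearAlgebra.FiniteDimensional.Lemmas
import HarnessLib

/-!
# Steer / CLAIM R kernel, file R3a: the chart dictionary of a point blow-up — residue basis, growth,
# regularity of `S/(X, w)` and maximality of the image ideal, for a localisation `S = B_𝔮` and a chart map `Θ : B ↠ A`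

OURS (campaign res-hironaka, rung L ★L-G4, slot W4.1, crux `Steer` stmt-ResolutionOfSingularities-16345; res-L0-w41-plan-1
RULING 160d «CLAIM R kernel `exists_regularCurveGerm_of_nonRational`», RULING 171c/179e; res-L0-w41-idea-3 g9; consumer = (K-H)
`LemmaI.GeomSupplyRegularCurve` of `L/res-L0-w41-idea-3/LemmaISketch.lean` v3.3; replaces the role of no printed item; NOT a statement of
the manuscript under review [claim: Hironaka2017, status: under-review]; AI review is weaker than expert review). Theses-free,
definition-free, pure commutative algebra.

SETTING. `B → S` an algebra with `S` the localisation of `B` at a prime `𝔮` (`IsLocalization.AtPrime S 𝔮`), `Θ : B ↠ A` a ring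
surjection and `𝔫 ⊂ A` an ideal with `Θ⁻¹ 𝔫 = 𝔮` (in the application: `B = S₀[𝔪₀/X] ⊆ S = S₁ ⊆ L` a quadratic transform,
`A = κ₀[T₁, T₂] = B/XB` the exceptional chart, `𝔫` the point). PROVED:

* `exists_residue_basis` — for `𝔫` maximal and `A` a `K`-algebra with `[A/𝔫 : K] = q < ∞`, coefficients `R₀ → B` whose `Θ`-images are
  the scalars `K` (`Θ ∘ ι₀ = algebraMap ∘ ρ`, `ρ : R₀ ↠ K` with kernel `𝔪_{R₀}`): there are `u₁ … u_q ∈ S` with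
  (i) `Σ aᵢ uᵢ ∈ 𝔪_S ⇒ aᵢ ∈ 𝔪_{R₀}` and (ii) every `z ∈ S` is `≡ Σ aᵢ uᵢ (mod 𝔪_S)` — a residue basis;
* `two_le_finrank_of_growth` — if some `z ∈ S` is congruent to no `ι₀ v`, then `q ≥ 2`;
* `isRegularLocalRing_quotient_span_pair` — for `A` a regular ring, `𝔫` maximal, `(ker Θ) S = (X')` and `w ∈ B` with
  `Θ w ∈ 𝔫 ∖ 𝔫²`: `S/(X', w)` is a regular local ring and `dim S/(X', w) + 1 = dim S/(X')` (`S/X'S = (B/ker Θ)_{𝔮̄} ≅ A_𝔫` is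
  regular, `w̄ ∈ 𝔪 ∖ 𝔪²` because `𝔫²` is `𝔫`-primary, then Matsumura 14.2 = tree `IsRegularLocalRing.quotient_span_singleton`);
* `isMaximal_map_of_height` — for `ker Θ = (X_b)` principal with `X_b ∈ 𝔮`, `dim A = n` finite and `ht 𝔮 = n + 1`: `Θ(𝔮)` is a
  maximal ideal (Krull: `ht 𝔮 ≤ ht (𝔮/X_b) + 1`, Mathlib `Ideal.height_le_height_add_one_of_mem`).
[cite: Matsumura1987, Thm. 14.2] [cite: StacksProject, Tag 02LY] [folklore]
-/

noncomputable section

-- single-problem summit: the doubled namespace component `ResolutionOfSingularities` is forced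
set_option linter.dupNamespace false

namespace Summit.ResolutionOfSingularities.ResolutionOfSingularities.Theorems.SwitchingDichotomy.ClaimR

open IsLocalRing Literature.AlgebraicGeometry.Resolution Module

universe u v

section Chart

variable {B S : Type u} {A : Type v} [CommRing B] [CommRing S] [CommRing A] [Algebra B S]
  (𝔮 : Ideal B) [𝔮.IsPrime] [IsLocalization.AtPrime S 𝔮] [IsLocalRing S]
  (Θ : B →+* A) {𝔫 : Ideal A} (h𝔫 : 𝔫.comap Θ = 𝔮)

include h𝔫 in
/-- `b ∈ B` maps into `𝔪_S` iff `Θ b ∈ 𝔫` (`𝔪_S ∩ B = 𝔮 = Θ⁻¹ 𝔫`). [folklore] -/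
theorem algebraMap_mem_maximalIdeal_iff (b : B) : algebraMap B S b ∈ maximalIdeal S ↔ Θ b ∈ 𝔫 := by
  rw [IsLocalization.AtPrime.to_map_mem_maximal_iff S 𝔮, ← h𝔫, Ideal.mem_comap]

include h𝔫 in
/-- The congruence step: if `z · s = r` in `S` with `s ∉ 𝔮` and `Θ r ≡ Θ s · Θ y (mod 𝔫)`, then `z ≡ y (mod 𝔪_S)`. [folklore] -/
theorem sub_algebraMap_mem_maximalIdeal {z : S} {r y : B} {s : 𝔮.primeCompl}
    (hrs : z * algebraMap B S s = algebraMap B S r)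
    (hy : Ideal.Quotient.mk 𝔫 (Θ r) = Ideal.Quotient.mk 𝔫 (Θ s) * Ideal.Quotient.mk 𝔫 (Θ y)) :
    z - algebraMap B S y ∈ maximalIdeal S := by
  have hs : algebraMap B S (s : B) ∉ maximalIdeal S := by
    rw [IsLocalization.AtPrime.to_map_mem_maximal_iff S 𝔮]
    exact s.2
  have hmem : algebraMap B S (r - s * y) ∈ maximalIdeal S := by
    rw [algebraMap_mem_maximalIdeal_iff 𝔮 Θ h𝔫, ← Ideal.Quotient.eq_zero_iff_mem, map_sub, map_mul, map_sub,
      map_mul, hy, sub_self]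
  have hprod : (z - algebraMap B S y) * algebraMap B S (s : B) ∈ maximalIdeal S := by
    have e : (z - algebraMap B S y) * algebraMap B S (s : B) = algebraMap B S (r - s * y) := by
      rw [sub_mul, hrs, map_sub, map_mul]; ring
    rw [e]; exact hmem
  exact ((Ideal.IsPrime.mem_or_mem inferInstance hprod).resolve_right hs)

/-! ## The residue basis and residue-field growth -/

section Residue

variable [𝔫.IsMaximal] {K : Type*} [Field K] [Algebra K A] [Module.Finite K (A ⧸ 𝔫)]
  {R₀ : Type*} [CommRing R₀] [IsLocalRing R₀] (ι₀ : R₀ →+* B) (ρ : R₀ →+* K)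
  (hρ : Function.Surjective ρ) (hρker : ∀ a, ρ a = 0 ↔ a ∈ maximalIdeal R₀)
  (hcomm : ∀ a, Θ (ι₀ a) = algebraMap K A (ρ a))

include h𝔫 hρ hρker hcomm in
/-- **Residue basis.** With `q = [A/𝔫 : K]` there are `u₁, …, u_q ∈ S` whose residues form a `κ(R₀)`-basis of `κ(S)`:
(i) `Σ aᵢ uᵢ ∈ 𝔪_S ⇒ all aᵢ ∈ 𝔪_{R₀}`, (ii) every `z ∈ S` is congruent mod `𝔪_S` to some `Σ aᵢ uᵢ`. [folklore] -/
theorem exists_residue_basis (hΘ : Function.Surjective Θ) :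
    ∃ u : Fin (finrank K (A ⧸ 𝔫)) → S,
      (∀ a : Fin (finrank K (A ⧸ 𝔫)) → R₀,
          (∑ i, algebraMap B S (ι₀ (a i)) * u i) ∈ maximalIdeal S → ∀ i, a i ∈ maximalIdeal R₀) ∧
      (∀ z : S, ∃ a : Fin (finrank K (A ⧸ 𝔫)) → R₀,
          z - ∑ i, algebraMap B S (ι₀ (a i)) * u i ∈ maximalIdeal S) := by
  classical
  letI := Ideal.Quotient.field 𝔫
  let b := Module.finBasis K (A ⧸ 𝔫)
  have hmkΘ : Function.Surjective (fun x : B => Ideal.Quotient.mk 𝔫 (Θ x)) :=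
    Ideal.Quotient.mk_surjective.comp hΘ
  choose ut hut using fun i => hmkΘ (b i)
  have key : ∀ a : Fin (finrank K (A ⧸ 𝔫)) → R₀,
      Ideal.Quotient.mk 𝔫 (Θ (∑ i, ι₀ (a i) * ut i)) = ∑ i, ρ (a i) • b i := by
    intro a
    simp only [map_sum, map_mul, hcomm, Ideal.Quotient.mk_algebraMap, hut, Algebra.smul_def]
  have hmap : ∀ a : Fin (finrank K (A ⧸ 𝔫)) → R₀,
      (∑ i, algebraMap B S (ι₀ (a i)) * algebraMap B S (ut i)) = algebraMap B S (∑ i, ι₀ (a i) * ut i) := by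
    intro a; simp only [map_sum, map_mul]
  refine ⟨fun i => algebraMap B S (ut i), fun a ha i => ?_, fun z => ?_⟩
  · rw [hmap, algebraMap_mem_maximalIdeal_iff 𝔮 Θ h𝔫, ← Ideal.Quotient.eq_zero_iff_mem, key] at ha
    exact (hρker _).mp (Fintype.linearIndependent_iff.mp b.linearIndependent _ ha i)
  · obtain ⟨⟨r, s⟩, hrs⟩ := IsLocalization.surj 𝔮.primeCompl z
    have hsn : Ideal.Quotient.mk 𝔫 (Θ s) ≠ 0 := by
      rw [Ne, Ideal.Quotient.eq_zero_iff_mem, ← Ideal.mem_comap, h𝔫]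
      exact s.2
    set e : A ⧸ 𝔫 := Ideal.Quotient.mk 𝔫 (Θ r) * (Ideal.Quotient.mk 𝔫 (Θ s))⁻¹ with he
    choose a ha using fun i => hρ (b.repr e i)
    refine ⟨a, ?_⟩
    rw [hmap]
    refine sub_algebraMap_mem_maximalIdeal 𝔮 Θ h𝔫 hrs ?_
    rw [key]
    simp_rw [ha]
    rw [b.sum_repr e, he, mul_comm, mul_assoc, inv_mul_cancel₀ hsn, mul_one]

omit [IsLocalRing R₀] in
include h𝔫 hρ hcomm in
/-- **Residue-field growth forces `q ≥ 2`.** If some `z ∈ S` is congruent mod `𝔪_S` to no element `ι₀ v`, `v ∈ R₀`, then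
`[A/𝔫 : K] ≥ 2`. [folklore] -/
theorem two_le_finrank_of_growth (hgrow : ∃ z : S, ∀ v : R₀, z - algebraMap B S (ι₀ v) ∉ maximalIdeal S) :
    2 ≤ finrank K (A ⧸ 𝔫) := by
  classical
  letI := Ideal.Quotient.field 𝔫
  by_contra hq
  obtain ⟨v₀, hv₀⟩ := (finrank_le_one_iff (K := K) (V := A ⧸ 𝔫)).mp (by omega)
  obtain ⟨z, hz⟩ := hgrow
  obtain ⟨⟨r, s⟩, hrs⟩ := IsLocalization.surj 𝔮.primeCompl z
  have hsn : Ideal.Quotient.mk 𝔫 (Θ s) ≠ 0 := by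
    rw [Ne, Ideal.Quotient.eq_zero_iff_mem, ← Ideal.mem_comap, h𝔫]
    exact s.2
  set e : A ⧸ 𝔫 := Ideal.Quotient.mk 𝔫 (Θ r) * (Ideal.Quotient.mk 𝔫 (Θ s))⁻¹ with he
  obtain ⟨c₁, hc₁⟩ := hv₀ 1
  obtain ⟨c, hc⟩ := hv₀ e
  have hc₁0 : c₁ ≠ 0 := by
    rintro rfl
    rw [zero_smul] at hc₁
    exact zero_ne_one hc₁
  -- `e = (c / c₁) • 1` is a scalar
  have hescal : e = algebraMap K (A ⧸ 𝔫) (c * c₁⁻¹) := by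
    rw [Algebra.algebraMap_eq_smul_one, ← hc, ← hc₁, smul_smul, mul_assoc, inv_mul_cancel₀ hc₁0, mul_one]
  obtain ⟨v, hv⟩ := hρ (c * c₁⁻¹)
  refine hz v (sub_algebraMap_mem_maximalIdeal 𝔮 Θ h𝔫 hrs ?_)
  rw [hcomm, Ideal.Quotient.mk_algebraMap, hv, ← hescal, he, mul_comm, mul_assoc, inv_mul_cancel₀ hsn, mul_one]

end Residue

/-! ## Regularity of `S/(X', w)` -/

omit [IsLocalRing S] in
include h𝔫 in
/-- **`S/(X', w)` is a regular local ring of dimension `dim S/(X') − 1`** when `A` is a regular ring, `𝔫` is maximal,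
`(ker Θ)·S = (X')` and `Θ w ∈ 𝔫 ∖ 𝔫²`: `S/X'S` is the localisation of `B/ker Θ ≅ A` at `𝔫`, hence regular, its maximal ideal is
`𝔫 S/X'S`, and `w̄ ∉ 𝔪²` because `𝔫²` is `𝔫`-primary; then Matsumura Thm. 14.2. [cite: Matsumura1987, Thm. 14.2]
[cite: StacksProject, Tag 02LY] -/
theorem isRegularLocalRing_quotient_span_pair [IsRegularRing A] [𝔫.IsMaximal] (hΘ : Function.Surjective Θ)
    {X' : S} (hX : (RingHom.ker Θ).map (algebraMap B S) = Ideal.span {X'})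
    {w : B} (hw : Θ w ∈ 𝔫) (hw2 : Θ w ∉ 𝔫 ^ 2) :
    IsRegularLocalRing (S ⧸ Ideal.span ({X', algebraMap B S w} : Set S)) ∧
      ringKrullDim (S ⧸ Ideal.span ({X', algebraMap B S w} : Set S)) + 1 =
        ringKrullDim (S ⧸ Ideal.span ({X'} : Set S)) := by
  classical
  set E : Ideal B := RingHom.ker Θ with hE
  have hE𝔮 : E ≤ 𝔮 := by
    rw [← h𝔫, hE, RingHom.ker_eq_comap_bot]
    exact Ideal.comap_mono bot_le
  -- `B/E ≅ A` is a regular ring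
  let θ : B ⧸ E ≃+* A := RingHom.quotientKerEquivOfSurjective hΘ
  have hθmk : ∀ b : B, θ (Ideal.Quotient.mk E b) = Θ b := fun b => rfl
  haveI : IsRegularRing (B ⧸ E) := IsRegularRing.of_ringEquiv θ.symm
  -- the prime `𝔮/E`, which is `θ⁻¹ 𝔫`, maximal
  haveI h𝔮p : (𝔮.map (Ideal.Quotient.mk E)).IsPrime := isPrime_map_quotientMk_of_le hE𝔮
  have h𝔮eq : 𝔮.map (Ideal.Quotient.mk E) = 𝔫.comap θ.toRingHom := by
    have h1 : 𝔮 = (𝔫.comap θ.toRingHom).comap (Ideal.Quotient.mk E) := by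
      rw [← h𝔫, Ideal.comap_comap]; rfl
    rw [h1, Ideal.map_comap_of_surjective _ Ideal.Quotient.mk_surjective]
  haveI h𝔮max : (𝔮.map (Ideal.Quotient.mk E)).IsMaximal := by
    rw [h𝔮eq]; exact Ideal.comap_isMaximal_of_surjective _ θ.surjective
  have hmem𝔮 : ∀ b : B, Ideal.Quotient.mk E b ∈ 𝔮.map (Ideal.Quotient.mk E) ↔ Θ b ∈ 𝔫 := by
    intro b; rw [h𝔮eq, Ideal.mem_comap]; exact Iff.rfl
  -- `S/ES` is the localisation of `B/E` at `𝔮/E`, hence a regular local ring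
  set R := S ⧸ E.map (algebraMap B S) with hR
  haveI hloc : IsLocalization.AtPrime R (𝔮.map (Ideal.Quotient.mk E)) :=
    isLocalization_atPrime_quotient_mapExt_of_le hE𝔮 S
  haveI : IsLocalRing R := IsLocalization.AtPrime.isLocalRing R (𝔮.map (Ideal.Quotient.mk E))
  haveI hRreg : IsRegularLocalRing R :=
    IsRegularLocalRing.of_ringEquiv
      (IsLocalization.algEquiv (𝔮.map (Ideal.Quotient.mk E)).primeCompl
        (Localization.AtPrime (𝔮.map (Ideal.Quotient.mk E))) R).toRingEquiv
  -- the element `w̄ ∈ 𝔪_R ∖ 𝔪_R²`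
  have hwR : algebraMap (B ⧸ E) R (Ideal.Quotient.mk E w) = Ideal.Quotient.mk _ (algebraMap B S w) := rfl
  have h1 : Ideal.Quotient.mk (E.map (algebraMap B S)) (algebraMap B S w) ∈ maximalIdeal R := by
    rw [← hwR, IsLocalization.AtPrime.to_map_mem_maximal_iff R (𝔮.map (Ideal.Quotient.mk E)), hmem𝔮]
    exact hw
  have h2 : Ideal.Quotient.mk (E.map (algebraMap B S)) (algebraMap B S w) ∉ maximalIdeal R ^ 2 := by
    intro hsq
    rw [← hwR, ← IsLocalization.AtPrime.map_eq_maximalIdeal (𝔮.map (Ideal.Quotient.mk E)) R,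
      ← Ideal.map_pow] at hsq
    obtain ⟨⟨y, t⟩, hyt⟩ :=
      (IsLocalization.mem_map_algebraMap_iff (𝔮.map (Ideal.Quotient.mk E)).primeCompl R).mp hsq
    have heq : algebraMap (B ⧸ E) R (Ideal.Quotient.mk E w * t) = algebraMap (B ⧸ E) R y := by
      rw [map_mul]; exact hyt
    obtain ⟨c, hc⟩ := (IsLocalization.eq_iff_exists (𝔮.map (Ideal.Quotient.mk E)).primeCompl R).mp heq
    have hprim : ((𝔮.map (Ideal.Quotient.mk E)) ^ 2).IsPrimary :=
      Ideal.isPrimary_of_isMaximal_radical (by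
        rw [Ideal.radical_pow _ two_ne_zero, Ideal.IsPrime.radical h𝔮p]; exact h𝔮max)
    have hin : Ideal.Quotient.mk E w * ((c : B ⧸ E) * t) ∈ (𝔮.map (Ideal.Quotient.mk E)) ^ 2 := by
      have : (c : B ⧸ E) * (Ideal.Quotient.mk E w * t) ∈ (𝔮.map (Ideal.Quotient.mk E)) ^ 2 := by
        rw [hc]; exact Ideal.mul_mem_left _ _ y.2
      convert this using 1; ring
    have hct : (c : B ⧸ E) * t ∉ ((𝔮.map (Ideal.Quotient.mk E)) ^ 2).radical := by
      rw [Ideal.radical_pow _ two_ne_zero, Ideal.IsPrime.radical h𝔮p]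
      exact fun h => ((Ideal.IsPrime.mem_or_mem h𝔮p h).elim c.2 t.2)
    have hwsq : Ideal.Quotient.mk E w ∈ (𝔮.map (Ideal.Quotient.mk E)) ^ 2 :=
      ((Ideal.isPrimary_iff.mp hprim).2 hin).resolve_right hct
    -- transport along `θ`: `Θ w ∈ 𝔫²`
    apply hw2
    have hmapθ : (𝔮.map (Ideal.Quotient.mk E)).map θ.toRingHom = 𝔫 := by
      rw [h𝔮eq]
      exact Ideal.map_comap_of_surjective θ.toRingHom (fun a => θ.surjective a) 𝔫
    rw [← hmapθ, ← Ideal.map_pow, ← hθmk]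
    exact Ideal.mem_map_of_mem _ hwsq
  -- Matsumura 14.2 in `R`
  obtain ⟨hreg, hdim⟩ := IsRegularLocalRing.quotient_span_singleton h1 h2
  -- transport `R/(w̄) ≅ S/(X', w)` and `R ≅ S/(X')`
  have hsup : E.map (algebraMap B S) ⊔ Ideal.span {algebraMap B S w} = Ideal.span {X', algebraMap B S w} := by
    rw [hX, ← Ideal.span_union, Set.singleton_union]
  let e₁ : R ⧸ Ideal.span {Ideal.Quotient.mk (E.map (algebraMap B S)) (algebraMap B S w)} ≃+*
      S ⧸ Ideal.span ({X', algebraMap B S w} : Set S) :=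
    (Ideal.quotEquivOfEq (by rw [Ideal.map_span, Set.image_singleton])).trans
      ((DoubleQuot.quotQuotEquivQuotSup (E.map (algebraMap B S)) (Ideal.span {algebraMap B S w})).trans
        (Ideal.quotEquivOfEq hsup))
  let e₂ : R ≃+* S ⧸ Ideal.span ({X'} : Set S) := Ideal.quotEquivOfEq hX
  haveI := hreg
  refine ⟨IsRegularLocalRing.of_ringEquiv e₁, ?_⟩
  rw [← ringKrullDim_eq_of_ringEquiv e₁, ← ringKrullDim_eq_of_ringEquiv e₂]
  exact hdim

end Chart

/-! ## Maximality of the image ideal by heights -/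

/-- **`Θ(𝔮)` is a maximal ideal** when `Θ : B ↠ A` has principal kernel `(X_b) ⊆ 𝔮`, `dim A = n < ∞` and `ht 𝔮 = n + 1`:
`ht 𝔮 ≤ ht(𝔮/X_b) + 1` (Krull), `B/(X_b) ≅ A`, so `ht Θ(𝔮) = n = dim A`. [cite: Matsumura1987, Thm. 13.5] -/
theorem isMaximal_map_of_height {B A : Type*} [CommRing B] [CommRing A] [IsNoetherianRing B]
    (𝔮 : Ideal B) [𝔮.IsPrime] (Θ : B →+* A) (hΘ : Function.Surjective Θ)
    {Xb : B} (hker : RingHom.ker Θ = Ideal.span {Xb}) (hX𝔮 : Xb ∈ 𝔮)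
    [FiniteRingKrullDim A] {n : ℕ} (hA : ringKrullDim A = n) (h𝔮 : 𝔮.height = n + 1) :
    (𝔮.map Θ).IsMaximal := by
  have hkerle : RingHom.ker Θ ≤ 𝔮 := by
    rw [hker, Ideal.span_le, Set.singleton_subset_iff]; exact hX𝔮
  haveI hp : (𝔮.map Θ).IsPrime := Ideal.map_isPrime_of_surjective hΘ hkerle
  -- `θ : B/(X_b) ≅ A` with `θ ∘ mk = Θ`
  let θ : B ⧸ Ideal.span {Xb} ≃+* A :=
    (Ideal.quotEquivOfEq hker.symm).trans (RingHom.quotientKerEquivOfSurjective hΘ)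
  have hθ : Ideal.map θ (𝔮.map (Ideal.Quotient.mk (Ideal.span {Xb}))) = 𝔮.map Θ := by
    change (𝔮.map (Ideal.Quotient.mk (Ideal.span {Xb}))).map θ.toRingHom = 𝔮.map Θ
    rw [Ideal.map_map]; rfl
  have h1 := Ideal.height_le_height_add_one_of_mem hX𝔮
  rw [← RingEquiv.height_map θ, hθ, h𝔮] at h1
  have h2 : ((𝔮.map Θ).height : WithBot ℕ∞) ≤ n := hA ▸ Ideal.height_le_ringKrullDim_of_ne_top hp.ne_top
  obtain ⟨m, hm⟩ := ENat.ne_top_iff_exists.mp ((𝔮.map Θ).height_ne_top hp.ne_top)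
  rw [← hm] at h1 h2
  have h1' : n + 1 ≤ m + 1 := by exact_mod_cast h1
  have h2' : m ≤ n := by exact_mod_cast h2
  have hmn : m = n := by omega
  exact Ideal.isMaximal_of_height_eq_ringKrullDim (by rw [hA, ← hm, hmn]; rfl)

end Summit.ResolutionOfSingularities.ResolutionOfSingularities.Theorems.SwitchingDichotomy.ClaimR
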